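import Mathlib
import Summits.ValiantsHypothesis.ValiantsHypothesis.Theses.LiouvilleSarnak
import Summits.ValiantsHypothesis.ValiantsHypothesis.Theorems.LiouvilleSarnakLiouvilleCutRankBoundedChanges
import Summits.ValiantsHypothesis.ValiantsHypothesis.Theorems.LiouvilleSarnakLiouvilleCutRankThresholdMinorTools

/-!
# Route LiouvilleSarnak — crux `LiouvilleCutRank` (stmt-ValiantsHypothesis-14775): the crux from its THRESHOLD MINORS
# (by-name reduction)

`Theorems/LiouvilleSarnakLiouvilleCutRankThresholdMinorTools.lean` computes the `(n+1) × (n+1)` threshold minor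
`T_π` of a cut matrix `M_π(λ)` in closed form — `T_π[a,b] = (-1)^{min(a,b)} λ(Q_π(a,b))`, `Q_π(a,b)` the odd WINDOW
NUMBER (`1` followed by the other letter's indicator of the window between `a` and `b`) — and `rank T_π ≤ rank M_π`.
With the landed bounded-changes class `…BoundedChanges.le_rank_of_changes_le` (p830257; cf. the equivalence
`…ManyChanges.liouvilleCutRank_iff_manyChanges`, p831283) this gives the reduction recorded here:

* ★ `liouvilleCutRank_of_thresholdMinors` — if for every `W` there are `K, n₁` such that at every level `n ≥ n₁`
  every balanced cut whose word has `≥ K` letter changes has threshold minor of rank `≥ W`, then `LiouvilleCutRank`.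

So the OPEN crux is implied by a statement about explicit polynomial-size `±1` matrices of `λ`-values at window
numbers (numerically of rank `≥ min(#rows,#cols) - 2` on every tested word, `2n ≤ 22`; census evidence of this
hand).  Honest framing: a reformulation; `LiouvilleCutRank`, `DigitalBilinearLiouville`, `AlgebraicSarnak` stay
OPEN; nothing bears on `VP ≠ VNP`.  No definitions.
-/

set_option linter.dupNamespace false

noncomputable section

namespace Summit.ValiantsHypothesis.ValiantsHypothesis.Theorems.LiouvilleSarnakLiouvilleCutRank.ThresholdMinor

open ArithmeticFunction Finset

open Summit.ValiantsHypothesis.ValiantsHypothesis.Theses.LiouvilleSarnak (LiouvilleCutRank)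
open Summit.ValiantsHypothesis.ValiantsHypothesis.Theorems.LiouvilleSarnakLiouvilleCutRank.BoundedChanges
  (le_rank_of_changes_le)
open Summit.ValiantsHypothesis.ValiantsHypothesis.Theorems.LiouvilleSarnakLiouvilleCutRank.ThresholdMinorTools
  (rank_thresholdMinor_le_rank)

/-- ★ **The crux from its threshold minors.**  If for every `W` there are `K, n₁` such that at every level
`n ≥ n₁`, every balanced cut whose row/column word has `≥ K` letter changes has THRESHOLD MINOR of rank `≥ W`,
then `LiouvilleCutRank` holds (words with `< K` changes: `BoundedChanges.le_rank_of_changes_le`; the others: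
`rank T_π ≤ rank M_π`).  The
threshold minor is the explicit `(n+1) × (n+1)` matrix `((-1)^{min(a,b)} λ(Q_π(a,b)))` of
`ThresholdMinorTools.liouville_threshold_entry_lt/gt`. [this file] -/
theorem liouvilleCutRank_of_thresholdMinors
    (h : ∀ W : ℕ, ∃ K n₁ : ℕ, ∀ n : ℕ, n₁ ≤ n →
      ∀ (π : Fin n ⊕ Fin n ≃ Fin (2 * n)) (w : ℕ → Bool),
        (∀ j : Fin (2 * n), w j = (π.symm j).isLeft) →
        K ≤ ((range (2 * n - 1)).filter fun k => w k ≠ w (k + 1)).card →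
        W ≤ ((Matrix.of fun r c : Fin n → Bool =>
          (((liouville (Nat.ofBits (fun k : Fin (2 * n) => Sum.elim r c (π.symm k)) + 1) : ℤ) : ℂ))).submatrix
            (fun o : Option (Fin n) => fun i : Fin n =>
              o.elim true fun i₀ => decide ((π (Sum.inl i) : ℕ) < (π (Sum.inl i₀) : ℕ)))
            (fun o : Option (Fin n) => fun k : Fin n =>
              o.elim true fun k₀ => decide ((π (Sum.inr k) : ℕ) < (π (Sum.inr k₀) : ℕ)))).rank) :
    LiouvilleCutRank := by
  intro W
  obtain ⟨K, n₁, hK⟩ := h W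
  obtain ⟨n₀, hn₀⟩ := le_rank_of_changes_le K W
  refine ⟨max n₀ n₁, fun n hn π => ?_⟩
  set w : ℕ → Bool := fun k => if hk : k < 2 * n then (π.symm ⟨k, hk⟩).isLeft else false with hw_def
  have hw : ∀ j : Fin (2 * n), w j = (π.symm j).isLeft := fun j => by simp [hw_def, j.isLt]
  by_cases hc : ((range (2 * n - 1)).filter fun k => w k ≠ w (k + 1)).card ≤ K
  · exact hn₀ n (le_of_max_le_left hn) π w hw hc
  · exact (hK n (le_of_max_le_right hn) π w hw (by omega)).trans (rank_thresholdMinor_le_rank n π)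

end Summit.ValiantsHypothesis.ValiantsHypothesis.Theorems.LiouvilleSarnakLiouvilleCutRank.ThresholdMinor

end
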